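import Summits.ValiantsHypothesis.ValiantsHypothesis.Theses.PartialSorting
import Summits.ValiantsHypothesis.ValiantsHypothesis.Theorems.PartialSortingBruhatDetInVNP
import Literature.Computability.AlgebraicComplexity.ValiantBooleanBridge
import Literature.Computability.AlgebraicComplexity.ValiantConjectureCompleteCriterion
import Literature.Computability.AlgebraicComplexity.ValiantCompleteness
import Literature.Computability.AlgebraicComplexity.DepthReduction

/-!
# Strategist sketch — cstrat stmt-ValiantsHypothesis-13590 (`PartialSorting.Target`), RESTATED re-audit (gen 1)

Companion of `STRATEGY-CENSUS.md` (same crux directory).  Every "signature" quoted in the census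
elaborates here (`lean check` rc 0, 0 sorry).  Contents:

* §0  `target_iff_S : PerProjectsToCutDet → (Target ↔ S)` — `Target → S` uses only proved support, `S → Target`
      needs the open completeness crux: `Target` is ONE-WAY at-least-summit, not a landed equivalence;
* §D1–§D7  the typed decomposition candidates for `Target` with their assemblies — each assembly is
      quoted verbatim in the census to show WHERE it violates (a)/(b)/(c);
* §T/§S  the transfer and strengthening signatures (`PerProjectsToSomeBruhatDet`, `WidthAxisHard`,
      `WindowUniversality`).
-/

set_option linter.dupNamespace false

open Literature.Computability.AlgebraicComplexity
open Summit.ValiantsHypothesis.ValiantsHypothesis.Theses.PartialSorting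

namespace Summit.ValiantsHypothesis.ValiantsHypothesis.Cruxes.Target.Strategist

noncomputable section

/-- The rank-truncated determinant family `D_w` of the route (verbatim sub-term of `Target`). -/
def bruhatDet (w : (n : ℕ) → Fin n → Fin n) (n : ℕ) : MvPolynomial (Fin n × Fin n) ℂ :=
  ∑ σ : Equiv.Perm (Fin n), if (∀ i j : Fin n, (Finset.univ.filter (fun a : Fin n => a ≤ i ∧ j ≤ σ a)).card ≤ (Finset.univ.filter (fun a : Fin n => a ≤ i ∧ j ≤ (w n) a)).card) then Equiv.Perm.sign σ • ∏ a : Fin n, MvPolynomial.X (a, σ a) else (0 : MvPolynomial (Fin n × Fin n) ℂ)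

/-- The explicit sequence `w⋆` of the route (cut-width `⌊n/4⌋` generator). -/
def wStar : (n : ℕ) → Fin n → Fin n :=
  fun n a => if ((a : ℕ) < n / 4 ∨ n - n / 4 ≤ (a : ℕ)) then Fin.rev a else a

/-- The width-`c` truncation `T(N,c) := Σ_{σ ∈ S_N : d_t(σ) ≤ c ∀ t} sgn σ x^σ` (the route's `BoundedWidthInVP` sub-term with `c` free). -/
def widthTrunc (c N : ℕ) : MvPolynomial (Fin N × Fin N) ℂ :=
  ∑ σ : Equiv.Perm (Fin N), if (∀ t : Fin N, (Finset.univ.filter (fun a : Fin N => a ≤ t ∧ t < σ a)).card ≤ c) then Equiv.Perm.sign σ • ∏ a : Fin N, MvPolynomial.X (a, σ a) else (0 : MvPolynomial (Fin N × Fin N) ℂ)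

theorem target_iff : Target ↔ ∃ w, ¬ IsVPFamily (bruhatDet w) := Iff.rfl
theorem cutDetNotVP_iff : CutDetNotVP ↔ ¬ IsVPFamily (bruhatDet wStar) := Iff.rfl
theorem perProjectsToCutDet_iff :
    PerProjectsToCutDet ↔ IsPProjection (fun n => perPoly (Fin n) ℂ) (bruhatDet wStar) := Iff.rfl

/-! ## §0 — `Target` is one-way at-least-summit -/

/-- `Target` is ONE-WAY at-least-summit: `Target → S` is the route's own `closes` with the PROVED support
`BruhatDetInVNP`; `S → Target` is available ONLY through the open rank-2 crux `PerProjectsToCutDet`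
(VNP-completeness of `CutDet`: with it `VP = VNP ↔ CutDet ∈ VP` by the complete-family criterion).  Stated as an
`Iff` under the open crux so that no audit reads it as a proof of an item. -/
theorem target_iff_S (hc : PerProjectsToCutDet) : Target ↔ _root_.ValiantsHypothesis := by
  refine ⟨fun h => closes h Summit.ValiantsHypothesis.ValiantsHypothesis.Theorems.bruhatDetInVNP_proof, fun hS => ?_⟩
  refine ⟨wStar, fun hVP => hS ?_⟩
  have hcomplete : IsVNPComplete (bruhatDet wStar) := by
    refine ⟨Summit.ValiantsHypothesis.ValiantsHypothesis.Theorems.bruhatDetInVNP_proof wStar, ?_⟩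
    intro v g hg
    exact IsPProjection.trans_holds ((isVNPComplete_perPoly_holds ℂ (by rw [ringChar.eq_zero]; norm_num)).2 v g hg) hc
  exact (VP_eq_VNP_iff_isVPFamily_of_isVNPComplete hcomplete).2 hVP

/-! ## §D1 — VBP lift + determinantal hardness (two OPEN pieces, both individually weaker than `S`; TRIVIAL seam) -/

/-- D1.X1 (open; a `VP = VP_ws` collapse on the Bruhat family): every rank-truncated determinant family that is
in `VP` is already a p-projection of the determinant. -/
def LiftToDet : Prop :=
  ∀ w : (n : ℕ) → Fin n → Fin n, IsVPFamily (bruhatDet w) → IsPProjection (bruhatDet w) (fun n => detPoly (Fin n) ℂ)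

/-- D1.X2 (open; gives only `VNP ⊄ VBP`, weaker than `VP ≠ VNP` [Burgisser2024 §2.8 p.11]): `CutDet` is not a
p-projection of `det`. -/
def CutDetNotDetProjection : Prop :=
  ¬ IsPProjection (bruhatDet wStar) (fun n => detPoly (Fin n) ℂ)

/-- D1 assembly — A ONE-LINER (modus tollens along a closure property): violates (b). -/
theorem target_of_D1 (h1 : LiftToDet) (h2 : CutDetNotDetProjection) : Target :=
  ⟨wStar, fun hVP => h2 (h1 wStar hVP)⟩

/-! ## §D6 — completeness + Valiant's dc-conjecture + VBP lift (three OPEN pieces; TRIVIAL seam) -/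

/-- D6.X2 = Valiant's 1979 conjecture in projection form (`≡ DcPerSuperpolynomial ℂ` up to Toda / Malod–Portier):
the permanent is not a p-projection of the determinant. -/
def PerNotDetProjection : Prop :=
  ¬ IsPProjection (fun n => perPoly (Fin n) ℂ) (fun n => detPoly (Fin n) ℂ)

/-- D6 assembly — ONE LINE of transitivity (`IsPProjection.trans_holds`): violates (b). -/
theorem target_of_D6 (h1 : PerProjectsToCutDet) (h2 : PerNotDetProjection) (h3 : LiftToDet) : Target :=
  ⟨wStar, fun hVP => h2 (IsPProjection.trans_holds h1 (h3 wStar hVP))⟩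

/-! ## §D2 — exact-width layer (one OPEN piece + one PROVABLE piece ⇒ the open piece is ≥ `Target` in substance) -/

/-- The exact-width-`m` layer `L_n := Σ_{σ : d_t(σ) = ⌊n/4⌋ at every binding cut, ≤ ⌊n/4⌋ elsewhere} sgn σ x^σ`
(the top weighted-homogeneous component of `CutDet_n` for the torus `x_ab ↦ λ^{#binding cuts in [a,b)} x_ab`). -/
def exactLayer (n : ℕ) : MvPolynomial (Fin n × Fin n) ℂ :=
  ∑ σ : Equiv.Perm (Fin n), if ((∀ t : Fin n, (Finset.univ.filter (fun a : Fin n => a ≤ t ∧ t < σ a)).card ≤ n / 4) ∧ (∀ t : Fin n, n / 4 ≤ (t : ℕ) → (t : ℕ) + 2 + n / 4 ≤ n → (Finset.univ.filter (fun a : Fin n => a ≤ t ∧ t < σ a)).card = n / 4)) then Equiv.Perm.sign σ • ∏ a : Fin n, MvPolynomial.X (a, σ a) else 0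

/-- D2.X1 (open): the exact layer is not a `VP` family. -/
def ExactLayerNotVP : Prop := ¬ IsVPFamily exactLayer

/-- D2.X2 (PROVABLE NOW — weighted-homogeneous component extraction by one-variable interpolation at `O(n²)` points,
[Burgisser2000] Lemma 2.14-type, plus `CutWidthIdeal`): if `CutDet ∈ VP` then its top torus-weight layer is in `VP`. -/
def LayerExtraction : Prop := IsVPFamily (bruhatDet wStar) → IsVPFamily exactLayer

/-- D2 assembly — one line; and since `LayerExtraction` is a theorem-to-be, `ExactLayerNotVP → Target` is provable:
the open piece is ≥ `Target` in substance (violates (c)) although the cheap probe fails (bc/ExactLayerNotVP_probe.lean). -/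
theorem target_of_D2 (h1 : ExactLayerNotVP) (h2 : LayerExtraction) : Target :=
  ⟨wStar, fun hVP => h1 (h2 hVP)⟩

/-! ## §D7 — depth-4 chasm (one OPEN piece + Tavenas, which is PROVED in tree ⇒ the open piece is ≥ `Target`) -/

/-- D7.X1 (open, barrier-class `DepthReductionChasm`): `CutDet` needs product-depth-2 circuits beyond the chasm,
i.e. for every `c` some `n` with `productDepthCircuitSize 2 (CutDet_n) > (n+2)^{c⌊√deg⌋+c}`. -/
def CutDetBeyondChasm : Prop :=
  ∀ c : ℕ, ∃ n : ℕ, ¬ (productDepthCircuitSize 2 (bruhatDet wStar n) ≤ ((n + 2 : ℕ∞) ^ (c * Nat.sqrt ((bruhatDet wStar n).totalDegree) + c)))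

/-- D7 assembly — Tavenas' depth reduction is the discharged tree fact `productDepthCircuitSize_two_le_of_isVPFamily_holds`,
so `CutDetBeyondChasm → Target` is a THEOREM (3 lines): k_open = 1 and the piece is ≥ `Target` (violates (c)). -/
theorem target_of_D7 (h1 : CutDetBeyondChasm) : Target := by
  refine ⟨wStar, fun hVP => ?_⟩
  obtain ⟨c, hc⟩ := productDepthCircuitSize_two_le_of_isVPFamily_holds (bruhatDet wStar) hVP
  obtain ⟨n, hn⟩ := h1 c
  exact hn (hc n)

/-! ## §D5 — Boolean transfer (Bürgisser, Cook's vs Valiant's hypothesis): pieces HARDER than `S`, typed at `S`-level -/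

/-- D5 assembly at summit level: ERH ∧ `NP ⊄ P/poly` ∧ Bürgisser's collapse fact (pnp.S26, a cite-tagged Literature `Prop`)
give `S`; composing with `target_of_S` needs `PerProjectsToCutDet` again.  Non-trivial seam?  No: four lines of logic —
all depth sits inside the literature fact, and the open Boolean piece is harder than `S` by that very fact. -/
theorem S_of_D5 (hERH : Literature.NumberTheory.LFunctions.ExtendedRiemannHypothesis)
    (hKL : Literature.Computability.Complexity.polyAdvice Literature.Computability.Complexity.Classes.P ≠
      Literature.Computability.Complexity.polyAdvice Literature.Computability.Complexity.Nondeterministic.NP)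
    (hB : burgisser_collapse_of_VP_eq_VNP_charZero ℂ) : _root_.ValiantsHypothesis := by
  intro hEq
  exact hKL (hB hERH hEq).1

theorem target_of_D5 (hERH : Literature.NumberTheory.LFunctions.ExtendedRiemannHypothesis)
    (hKL : Literature.Computability.Complexity.polyAdvice Literature.Computability.Complexity.Classes.P ≠
      Literature.Computability.Complexity.polyAdvice Literature.Computability.Complexity.Nondeterministic.NP)
    (hB : burgisser_collapse_of_VP_eq_VNP_charZero ℂ) (hc : PerProjectsToCutDet) : Target :=
  (target_iff_S hc).2 (S_of_D5 hERH hKL hB)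

/-! ## §T — transfer (character axis ⇒ completeness) and §S — strengthenings / robustness of the width axis -/

/-- Transfer of the step that IS proved on the sibling (character) axis — VNP-hardness: some rank-truncated
determinant is per-hard.  Weaker than `PerProjectsToCutDet` (any `w`), and it makes `Target ↔ S`. -/
def PerProjectsToSomeBruhatDet : Prop :=
  ∃ w : (n : ℕ) → Fin n → Fin n, IsPProjection (fun n => perPoly (Fin n) ℂ) (bruhatDet w)

/-- With the transferred step, `Target ↔ S`: the transfer CLOSES the gap upward, it does not split `Target`. -/
theorem target_iff_S' (hc : PerProjectsToSomeBruhatDet) : Target ↔ _root_.ValiantsHypothesis := by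
  refine ⟨fun h => closes h Summit.ValiantsHypothesis.ValiantsHypothesis.Theorems.bruhatDetInVNP_proof, fun hS => ?_⟩
  obtain ⟨w, hw⟩ := hc
  refine ⟨w, fun hVP => hS ?_⟩
  have hcomplete : IsVNPComplete (bruhatDet w) := by
    refine ⟨Summit.ValiantsHypothesis.ValiantsHypothesis.Theorems.bruhatDetInVNP_proof w, ?_⟩
    intro v g hg
    exact IsPProjection.trans_holds ((isVNPComplete_perPoly_holds ℂ (by rw [ringChar.eq_zero]; norm_num)).2 v g hg) hw
  exact (VP_eq_VNP_iff_isVPFamily_of_isVNPComplete hcomplete).2 hVP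

/-- §S1 (strengthening S⁺ = robust width-axis hardness): SOME width-profile truncation `(T(N, c_N))_N` is not in `VP`. -/
def WidthAxisHard : Prop :=
  ∃ c : ℕ → ℕ, ¬ IsVPFamily (fun N => widthTrunc (c N) N)

/-- §S2 (support-grade, provable bookkeeping; the route's "WindowReduction" made two-sided): every width truncation
`T(N,c)` with `2c ≤ N` is a projection of `CutDet_{n'}` for `n' = 4·max(c, ⌈(N-2c)/2⌉) ≤ 2N + 4`
(saturate `max(..) - c` budget units with forced outer transpositions, pad with trailing fixed points, one sign constant). -/
def WindowUniversality : Prop :=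
  ∀ N c : ℕ, 2 * c ≤ N → IsProjection (widthTrunc c N) (bruhatDet wStar (4 * max c ((N - 2 * c + 1) / 2)))

/-- §T3 (by-product, support-grade, provable bookkeeping): the LOW end of the width axis is already `VBP`-hard —
every layered ABP polynomial, in particular `IMM`, is a projection of a width-1 truncation `T(N,1)` (diagonal loops `= 1`
off the path, one feedback arc `t ↦ s`, `x_ss = x_tt = 0`; every surviving cycle cover is one increasing `s–t` path closed
by the feedback arc, forward cut-width exactly `1`, uniform sign).  With `BoundedWidthInVP` (c = 1, an ABP) this makes
`T(·,1) = D_{(1 n)}` VBP-complete, like the HIGH end `T(N, ⌊N/2⌋) = det_N`: both ends of the axis are VBP-complete. -/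
def WidthOneVBPHard : Prop :=
  IsPProjection (fun n => immPoly n n ℂ) (fun N => widthTrunc 1 N)

/-- §S3: hence `CutDetNotVP ↔ WidthAxisHard` modulo `WindowUniversality` + `CutWidthIdeal` (both provable):
the budget `⌊n/4⌋` is canonical on the width axis — a RESTATEMENT of the crux, not a split of it.
(Only the easy direction is recorded here; the converse needs the p-projection packaging of §S2.) -/
theorem widthAxisHard_of_cutDetNotVP (hCW : CutWidthIdeal) (h : CutDetNotVP) : WidthAxisHard := by
  refine ⟨fun N => N / 4, ?_⟩
  have hEq : (fun N => widthTrunc (N / 4) N) = bruhatDet wStar := by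
    funext N
    unfold widthTrunc bruhatDet wStar
    refine Finset.sum_congr rfl ?_
    intro σ _
    rw [if_congr (hCW N σ).symm rfl rfl]
  rw [hEq]
  exact h

end

end Summit.ValiantsHypothesis.ValiantsHypothesis.Cruxes.Target.Strategist
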